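import Literature.IUT.LogThetaLattice.GlobalPacketsLocalizationModel
import Literature.IUT.LogThetaLattice.GlobalPacketsLGPProofs
import Mathlib.NumberTheory.Cyclotomic.PrimitiveRoots
import HarnessLib

/-!
# [IUTchIII] Proposition 3.3 (ii): the two integrality predicates are SCHEMAS — universal-closure certificates (proofs only)

S. Mochizuki, *Inter-universal Teichmüller theory III*, kurims manuscript (May 2020), §3, Proposition 3.3
"(Global Tensor Packets)" (ii), p. 100 [claim: Mochizuki2012, status: disputed] (D-0012 claim key; the content
proved here is elementary). abc-iut cell, L-F family LF5/6 register row **LF6-13** (plan/L6/LF-IUT.tsv; seat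
abc-iut-w5-d230 gen 12); frozen FACT-LIST rows **F-2101** `Prop33ii_integersArc` and **F-2102**
`Prop33ii_integersNon` (abc-iut-L6-t4, `GlobalPacketsLGP.lean`), node **IUTchIII:Prop3.3(ii)**.
PROOF-ONLY (no `def`, no `instance`; nothing of the statement file is re-typed).

Both predicates take the integral structure of the codomain as a FREE argument (`Oarc : ∀ v_ℚ, Set (P v_ℚ)`
resp. `OA : ∀ v_ℚ, Subring (P v_ℚ)`) — "SLOTS (nothing to prove until the localization homomorphism [and the
integral structures of Prop. 3.1 (ii)] are constructed)" (`GlobalPacketsLGPProofs.lean`). Hence their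
universal closures are FALSE, and the rows are consumable only in INSTANCE FORM at the genuine carrier, where
the tree holds the theorems: abc-iut-w4-d037's `LocalizationModel.prop33ii_integersArc_model` /
`LocalizationModel.prop33ii_integersNon_model` (p412179; the number-field model of [IUTchIII] Rmk. 3.1.1 (i):
every label a copy of `K = F_mod`, local data the completions `K_v`, integral structures `integralPureTensors` /
`integralPacket`), with non-vacuity `locAt_single_inv_prime_not_mem` (p412179),
`locAt_single_two_not_mem_integralPureTensors` (abc-iut-w5-d039, p412907), `integralPacket_ne_top` /
`integralPureTensors_none_ne_univ` (p413639). The refutations below are taken AT THE GENUINE LOCALIZATION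
HOMOMORPHISM of that model, with only the free integral-structure slot filled degenerately:

* F-2101 — `not_prop33ii_integersArc_localizationHom_empty`: at the model over `K = ℚ` (one label) with the
  archimedean slot `Oarc := ∅`, the archimedean integer `0` is not sent into `∅`;
  `not_forall_prop33ii_integersArc` packages the universal closure.
* F-2102 — `not_prop33ii_integersNon_localizationHom_bot`: at the model over a number field `K` containing a
  primitive 4th root of unity `ζ` (one label) with the nonarchimedean slot `OA := ⊥` (the image of `ℤ`), the
  algebraic integer `ζ ∈ 𝓞_K` is not sent into `⊥` at `v_ℚ = 2` — by the injectivity of the localization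
  homomorphism (Prop. 3.3 (i), `locAt_injective`) and of `(†𝕄⊛_mod)_α → (†𝕄⊛_mod)_A`
  (`GlobalPacket.single_injective`) this would force `ζ ∈ ℤ`, whereas `ζ² = −1`;
  `not_forall_prop33ii_integersNon` packages the universal closure at `K = ℚ(ζ₄)` (Mathlib `CyclotomicField 4 ℚ`).

HONEST FRAMING: a refuted universal closure is a statement about OUR typing (the predicates admit degenerate
integral-structure arguments), not about the printed proposition, which concerns the integral structures of
[IUTchIII] Prop. 3.1 (ii) — where the cited instance-form theorems apply. Nothing here bears on [IUTchIII]
Cor. 3.12 or takes a side; typed ≠ proved; nothing asserts abc proved or refuted.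
-/

noncomputable section

namespace Literature.IUT.LogThetaLattice

open NumberField PiTensorProduct LocalizationModel
open scoped TensorProduct

/-! ## F-2101 `Prop33ii_integersArc` ([IUTchIII] Prop 3.3 (ii), archimedean clause) -/

/-- **IUTchIII:Prop3.3(ii)** (kurims p.100), archimedean clause: at the GENUINE localization homomorphism of the
number-field model (`K = ℚ`, one label) with the free archimedean integral-structure slot filled by `Oarc := ∅`,
the predicate `Prop33ii_integersArc` FAILS — the archimedean integer `0 ∈ (†𝕄⊛_mod)_α` (`‖σ 0‖ = 0 ≤ 1`) is not
sent into `∅`. [claim: Mochizuki2012, status: disputed] (IUTchIII §3 Prop 3.3 (ii), kurims p.100) -/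
theorem not_prop33ii_integersArc_localizationHom_empty :
    ¬ Prop33ii_integersArc (fun _ : Unit => ℚ) (packet ℚ Unit) (localizationHom ℚ Unit) IsArc
        (fun _ => (∅ : Set _)) () :=
  fun h => Set.notMem_empty _ (h none rfl 0 fun σ => by simp)

/-- **F-2101 is a schema**: the universal closure of `Prop33ii_integersArc` (over all label sets, labelled fields,
codomains, localization homomorphisms, place predicates and archimedean integral structures) is FALSE; the
instance form the cone uses is `LocalizationModel.prop33ii_integersArc_model` (p412179), non-vacuity
`LocalizationModel.locAt_single_two_not_mem_integralPureTensors` (p412907).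
[claim: Mochizuki2012, status: disputed] (IUTchIII §3 Prop 3.3 (ii), kurims p.100) -/
theorem not_forall_prop33ii_integersArc :
    ¬ ∀ (A : Type) [Fintype A] [DecidableEq A] (F : A → Type) [∀ α, Field (F α)] [∀ α, Algebra ℚ (F α)]
        (VQ : Type) (P : VQ → Type) [∀ vQ, CommRing (P vQ)] (loc : LocalizationHom F P)
        (isArc : VQ → Prop) (Oarc : ∀ vQ, Set (P vQ)) (α : A), Prop33ii_integersArc F P loc isArc Oarc α :=
  fun h => not_prop33ii_integersArc_localizationHom_empty (h Unit _ _ _ _ _ _ _)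

/-! ## F-2102 `Prop33ii_integersNon` ([IUTchIII] Prop 3.3 (ii), nonarchimedean clause) -/

/-- **IUTchIII:Prop3.3(ii)** (kurims p.100), nonarchimedean clause: at the GENUINE localization homomorphism of
the number-field model over a number field `K` containing a primitive 4th root of unity `ζ` (one label), with the
free nonarchimedean integral-structure slot filled by `OA := ⊥` (the image of `ℤ` in `log(^A𝓕_{v_ℚ})`), the
predicate `Prop33ii_integersNon` FAILS: the algebraic integer `ζ ∈ 𝓞_K` is not sent into `⊥` at `v_ℚ = 2`.
Indeed the localization homomorphism is injective (Prop. 3.3 (i), `locAt_injective`) and so is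
`(†𝕄⊛_mod)_α → (†𝕄⊛_mod)_A` (`GlobalPacket.single_injective`), so `ζ` would be a rational integer `n`, whereas
`ζ² = −1 < 0 ≤ n²`. [claim: Mochizuki2012, status: disputed] (IUTchIII §3 Prop 3.3 (ii), kurims p.100) -/
theorem not_prop33ii_integersNon_localizationHom_bot (K : Type) [Field K] [NumberField K] {ζ : K}
    (hζ : IsPrimitiveRoot ζ 4) :
    ¬ Prop33ii_integersNon (fun _ : Unit => K) (packet K Unit) (localizationHom K Unit) IsNon
        (fun _ => (⊥ : Subring _)) () := by
  intro h
  -- `ζ` is an algebraic integer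
  let x : 𝓞 K := ⟨ζ, hζ.isIntegral (by norm_num)⟩
  let v : VQ := some ⟨2, Nat.prime_two⟩
  -- the clause at `v_ℚ = 2`: the image of `ζ` lies in `⊥`, i.e. is the image of a rational integer `n`
  have hmem : locAt K Unit v (GlobalPacket.single (fun _ : Unit => K) () (x : K)) ∈
      (⊥ : Subring (packet K Unit v)) := by
    simpa only [localizationHom_apply] using h v rfl x
  obtain ⟨n, hn⟩ := Subring.mem_bot.mp hmem
  -- injectivity of the localization homomorphism and of `(†𝕄⊛_mod)_α → (†𝕄⊛_mod)_A`
  have h1 : (n : GlobalPacket (fun _ : Unit => K)) = GlobalPacket.single (fun _ : Unit => K) () (x : K) :=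
    locAt_injective K Unit v (by rw [map_intCast]; exact hn)
  haveI : Nontrivial (GlobalPacket (fun _ : Unit => K)) :=
    (PiTensorProduct.subsingletonEquiv (R := ℚ) (s := fun _ : Unit => K) ()).symm.injective.nontrivial
  have h2 : (n : K) = ζ :=
    GlobalPacket.single_injective (fun _ : Unit => K) () (by rw [map_intCast]; exact h1)
  -- but `ζ² = −1` is not the square of a rational integer
  have hsq : ζ ^ 2 = -1 :=
    (IsPrimitiveRoot.pow (by norm_num) hζ (show 4 = 2 * 2 by norm_num)).eq_neg_one_of_two_right
  rw [← h2] at hsq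
  have hint : (n : ℤ) ^ 2 = -1 := by exact_mod_cast hsq
  nlinarith [sq_nonneg n]

/-- **F-2102 is a schema**: the universal closure of `Prop33ii_integersNon` (over all label sets, labelled number
fields, codomains, localization homomorphisms, place predicates and nonarchimedean integral structures) is FALSE —
witness `K = ℚ(ζ₄)` (Mathlib `CyclotomicField 4 ℚ`); the instance form the cone uses is
`LocalizationModel.prop33ii_integersNon_model` (p412179), non-vacuity `LocalizationModel.locAt_single_inv_prime_not_mem`
(p412179) / `LocalizationModel.integralPacket_ne_top` (p413639).
[claim: Mochizuki2012, status: disputed] (IUTchIII §3 Prop 3.3 (ii), kurims p.100) -/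
theorem not_forall_prop33ii_integersNon :
    ¬ ∀ (A : Type) [Fintype A] [DecidableEq A] (F : A → Type) [∀ α, Field (F α)] [∀ α, Algebra ℚ (F α)]
        (VQ : Type) (P : VQ → Type) [∀ vQ, CommRing (P vQ)] [∀ α, NumberField (F α)]
        (loc : LocalizationHom F P) (isNon : VQ → Prop) (OA : ∀ vQ, Subring (P vQ)) (α : A),
        Prop33ii_integersNon F P loc isNon OA α := by
  intro h
  haveI : IsCyclotomicExtension {4} ℚ (CyclotomicField 4 ℚ) :=
    CyclotomicField.instIsCyclotomicExtensionSingletonNatSetOfCharZero 4 ℚ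
  haveI : NumberField (CyclotomicField 4 ℚ) := IsCyclotomicExtension.numberField {4} ℚ _
  exact not_prop33ii_integersNon_localizationHom_bot (CyclotomicField 4 ℚ)
    (IsCyclotomicExtension.zeta_spec 4 ℚ (CyclotomicField 4 ℚ)) (h Unit _ _ _ _ _ _ _)

end Literature.IUT.LogThetaLattice

end
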